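import Summits.QuantumFields.BalabanUV.T4Continuum.Support.NE7GradientCurrencyLandauEL
import Literature.MathematicalPhysics.QuantumFieldTheory.Balaban1983to89.Beta.PoissonInterior
import HarnessLib

/-!
# NE7LocalLandauLetters — THE CONDITIONAL LOCAL GRADIENT LETTER OF A LANDAU REPRESENTATIVE ON A CUBE: local-hypothesis clones of (158)'s flat∕covariant divergence
# comparison, of F5's curl-divergence letter and of (158b)'s reaction-gradient letter, assembled through (156)'s LOCAL interior letter into
# `‖∇A(x₀)‖ ≤ 2(d·a₀∕R + R·(J₀ + θ·G))` whenever `G` bounds `∇A` on the cube of radius `R + 1` about `x₀` — the input shape of G2 `NE7WeightedGradientBootstrap`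
# (file G1 of gen 112's BOX ROUTE to [Balaban1985Variational] Thm 1 (9)∕(10))

Cell `pub-balaban`, rung (B)+1 sub-cell t4, lineage `b2b-balaban-t4-ne7-p1` (CRUX PROVER NE7 #1 = OWNER of BINDER row NE7), generation 112.  Memo
`t4/b2b-balaban-t4-ne7-p1-g112/ROAD-G112.md` §5.  The torus∕global versions ((157) `norm_fdiff_le_of_plaqDiv_periodic`, (158) `gradient_currency_of_covDiv`, (158b), (162), F5, F6)
need the representative `W = e^{A}` and its letters on ALL of `ℤᵈ`; gen 93's Uhlenbeck gauge (`NE7CubeLandauChart.cube_landau_chart`) lives on a CUBE.  THIS FILE re-reads the three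
pointwise conversion letters with hypotheses restricted to the bonds and plaquettes they actually touch (proofs verbatim from the cited files), to be assembled (companion file
`NE7LocalLandauGradientLetter`) with the LOCAL letter (156) `NE7LatticeHodgeGradient.norm_fdiff_le_of_curl_div` (hypotheses on the cube of radius `R` about `x₀` only).
THE SETTING.  `W : ℤᵈ → (Fin d → U(n))` a configuration (in use: `W = U^{u}`, unitary, `SmallField W ε` everywhere, `‖covDiv 1 W‖ = ‖covDiv 1 U‖` by (1.11)), a bond field `A` and a cube
`{|y − c|_∞ ≤ S}` on which `W(y)_κ = expUnit (A(y)_κ)` and `‖A(y)_κ‖ ≤ a₀`; the `sinh`-Landau condition `Σ_κ [sinh A(y)_κ − sinh A(y − e_κ)_κ] = 0` at the sites of the cube.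
WHAT ([folklore]; 0 def, 0 sorry).  §1 `norm_plaqDivFlat_le_covDiv_local` ((158) §1 local), `hol_plaqWord_exp_local` (the four-factor product from four bond equalities),
`norm_curlDiv_le_of_plaqDiv_local` (F5 §1 local), `norm_dDiv_sub_dDiv_sinh_le_local` ((158b) §1 local).  §2 cube bookkeeping (`inCube_add_e`, `inCube_sub_e`) and
**`local_gradient_letter`**: for `x₀` with `{|y − x₀|_∞ ≤ R + 3} ⊆ {|y − c|_∞ ≤ S}` and `G` bounding `‖A(y+e_τ)_κ − A(y)_κ‖` for `|y − x₀|_∞ ≤ R + 1`: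
`‖A(x₀+e_τ)_κ − A(x₀)_κ‖ ≤ 2(d·a₀∕R + R·((j + dε((e^{2a₀}−1) + 2ε(2+ε))) + (4d(e^{4a₀}−1) + 2d(e^{a₀}−1))·G))`, `j ≥ sup‖covDiv 1 W‖`; and the companion LOCAL LAPLACIAN
letter **`local_laplacian_letter`** (`‖ΔA_ν(y)‖ ≤ (j + dε(…)) + (4d(e^{4a₀}−1) + 2d(e^{a₀}−1))·G` for `|y − x₀|_∞ ≤ R`).
HONEST FRAMING (page 1): lattice∕Banach-algebra bookkeeping at ONE configuration; `a₀`, `G`, `j` HYPOTHESES; nothing of Bałaban's asserted; nothing about minimisers; NOT NE3∕NE7 as spine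
nodes; spine 0∕9; finite T⁴ rung (B)+1 — NOT infinite volume, NOT mass gap, NOT BetaPertH, NOT Clay (continuum YM on T⁴ ⇐ BetaPertH ∧ nine spine estimates).
-/

set_option autoImplicit false

open NormedSpace
open scoped BigOperators Matrix Matrix.Norms.L2Operator
open Finset

namespace Summit.QuantumFields.BalabanUV.T4Continuum.NE7LocalLandauLetters

open Literature.MathematicalPhysics.QuantumFieldTheory.Balaban1983to89
open B7Prop1Explicit B7Prop2Explicit
open B7Eq78Linearization (conjR conjR_apply conjR_sub conjR_one)
open B8Ineq132 (covDiv covDeriv plaqF)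
open T4AveragingDeficitWall (SmallField)
open NE7LatticeHodgeGradient (laplacian_eq_sum_dCurl_add_dDiv norm_fdiff_le_of_curl_div)
open NE7GradientCurrency (norm_conj_sub_self_le norm_plaqRem_sub_plaqRem_le)
open NE7GradientCurrencyCovariant (hol_plaqWord_swap' covDiv_one_eq_sum_ite norm_sum_le_norm_add_of_termwise norm_inv_sub_inv_add_sub_le
  norm_conjR_sub_self_le norm_expUnit_sub_one_le')
open NE7GradientCurrencyLandauEL (norm_sinhRem_sub_sinhRem_le)

noncomputable section

variable {d : ℕ} {n : Type*} [Fintype n] [DecidableEq n] [Nonempty n]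

/-! ## §1 The three pointwise conversion letters with local hypotheses -/

/-- **THE FLAT CO-DIFFERENTIAL OF THE PLAQUETTE DEVIATION AGAINST THE COVARIANT DIVERGENCE (1.2), LOCAL HYPOTHESES** (clone of (158)
`NE7GradientCurrencyCovariant.norm_plaqDivFlat_le_covDiv` with the bond-radius and plaquette hypotheses restricted to the bonds `(x − e_μ, μ)` and the plaquettes
`∂p(x)`, `∂p(x − e_μ)` that the estimate at `x` actually reads): `‖Σ_μ [(W(∂p_{μν}(x)) − 1) − (W(∂p_{μν}(x−e_μ)) − 1)]‖ ≤ ‖covDiv 1 W ν x‖ + d·(ε·b₀·(2 + b₀) + 2ε²(2 + ε))`.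
[folklore] -/
theorem norm_plaqDivFlat_le_covDiv_local (W : Site d → Fin d → (Matrix n n ℂ)ˣ) {b₀ ε : ℝ} (hε0 : 0 ≤ ε) (hb0 : 0 ≤ b₀) (x : Site d) (ν : Fin d)
    (hWb : ∀ μ : Fin d, ‖((W (x - e μ) μ : (Matrix n n ℂ)ˣ) : (Matrix n n ℂ)) - 1‖ ≤ b₀ ∧ ‖(((W (x - e μ) μ)⁻¹ : (Matrix n n ℂ)ˣ) : (Matrix n n ℂ)) - 1‖ ≤ b₀)
    (hWε : ∀ (μ κ κ' : Fin d), κ ≠ κ' → ‖((hol W x (plaqWord κ κ') : (Matrix n n ℂ)ˣ) : Matrix n n ℂ) - 1‖ ≤ ε ∧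
      ‖((hol W (x - e μ) (plaqWord κ κ') : (Matrix n n ℂ)ˣ) : Matrix n n ℂ) - 1‖ ≤ ε) :
    ‖∑ μ, ((((hol W x (plaqWord μ ν) : (Matrix n n ℂ)ˣ) : (Matrix n n ℂ)) - 1) - (((hol W (x - e μ) (plaqWord μ ν) : (Matrix n n ℂ)ˣ) : (Matrix n n ℂ)) - 1))‖
      ≤ ‖covDiv 1 W ν x‖ + d * (ε * b₀ * (2 + b₀) + 2 * ε * ε * (2 + ε)) := by
  classical
    have hK0 : 0 ≤ 2 * ε * ε * (2 + ε) := mul_nonneg (mul_nonneg (mul_nonneg (by norm_num) hε0) hε0) (by linarith)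
  -- transport defect
  have htrans : ∀ (μ : Fin d) (Y : (Matrix n n ℂ)ˣ), ‖(Y : (Matrix n n ℂ)) - 1‖ ≤ ε →
      ‖conjR (W (x - e μ) μ)⁻¹ (Y : (Matrix n n ℂ)) - (Y : (Matrix n n ℂ))‖ ≤ ε * b₀ * (2 + b₀) := by
    intro μ Y hY
    have hV1 : ‖(((W (x - e μ) μ)⁻¹ : (Matrix n n ℂ)ˣ) : (Matrix n n ℂ)) - 1‖ ≤ b₀ := (hWb μ).2
    have hV2 : ‖((((W (x - e μ) μ)⁻¹)⁻¹ : (Matrix n n ℂ)ˣ) : (Matrix n n ℂ)) - 1‖ ≤ b₀ := by rw [inv_inv]; exact (hWb μ).1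
    have hV3 : ‖((((W (x - e μ) μ)⁻¹)⁻¹ : (Matrix n n ℂ)ˣ) : (Matrix n n ℂ))‖ ≤ 1 + b₀ := by
      have h := norm_le_norm_add_norm_sub' ((((W (x - e μ) μ)⁻¹)⁻¹ : (Matrix n n ℂ)ˣ) : (Matrix n n ℂ)) 1
      rw [norm_one] at h
      linarith
    have hid : conjR (W (x - e μ) μ)⁻¹ (Y : (Matrix n n ℂ)) - (Y : (Matrix n n ℂ)) = conjR (W (x - e μ) μ)⁻¹ ((Y : (Matrix n n ℂ)) - 1) - ((Y : (Matrix n n ℂ)) - 1) := by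
      rw [conjR_sub, conjR_one]; abel
    rw [hid]
    refine (norm_conjR_sub_self_le _ _).trans ?_
    calc (‖(((W (x - e μ) μ)⁻¹ : (Matrix n n ℂ)ˣ) : (Matrix n n ℂ)) - 1‖ * ‖((((W (x - e μ) μ)⁻¹)⁻¹ : (Matrix n n ℂ)ˣ) : (Matrix n n ℂ))‖
            + ‖((((W (x - e μ) μ)⁻¹)⁻¹ : (Matrix n n ℂ)ˣ) : (Matrix n n ℂ)) - 1‖) * ‖(Y : (Matrix n n ℂ)) - 1‖
        ≤ (b₀ * (1 + b₀) + b₀) * ε :=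
          mul_le_mul (add_le_add (mul_le_mul hV1 hV3 (norm_nonneg _) hb0) hV2) hY (norm_nonneg _) (by positivity)
      _ = ε * b₀ * (2 + b₀) := by ring
  refine norm_sum_le_norm_add_of_termwise
    (fun μ => (((hol W x (plaqWord μ ν) : (Matrix n n ℂ)ˣ) : (Matrix n n ℂ)) - 1) - (((hol W (x - e μ) (plaqWord μ ν) : (Matrix n n ℂ)ˣ) : (Matrix n n ℂ)) - 1))
    (fun μ => if μ < ν then conjR (W (x - e μ) μ)⁻¹ (plaqF W μ ν (x - e μ)) - plaqF W μ ν x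
      else if ν < μ then -(conjR (W (x - e μ) μ)⁻¹ (plaqF W ν μ (x - e μ)) - plaqF W ν μ x) else 0)
    (covDiv_one_eq_sum_ite W ν x) fun μ => ?_
  -- the termwise bound
  by_cases h1 : μ < ν
  · have hne : μ ≠ ν := ne_of_lt h1
    have hε : ‖((hol W (x - e μ) (plaqWord μ ν) : (Matrix n n ℂ)ˣ) : (Matrix n n ℂ)) - 1‖ ≤ ε := (hWε μ μ ν hne).2
    have hval : ((((hol W x (plaqWord μ ν) : (Matrix n n ℂ)ˣ) : (Matrix n n ℂ)) - 1) - (((hol W (x - e μ) (plaqWord μ ν) : (Matrix n n ℂ)ˣ) : (Matrix n n ℂ)) - 1))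
        + (if μ < ν then conjR (W (x - e μ) μ)⁻¹ (plaqF W μ ν (x - e μ)) - plaqF W μ ν x
            else if ν < μ then -(conjR (W (x - e μ) μ)⁻¹ (plaqF W ν μ (x - e μ)) - plaqF W ν μ x) else 0)
        = conjR (W (x - e μ) μ)⁻¹ (plaqF W μ ν (x - e μ)) - plaqF W μ ν (x - e μ) := by
      simp only [h1, ↓reduceIte, plaqF]; abel
    rw [hval]
    exact (htrans μ (hol W (x - e μ) (plaqWord μ ν)) hε).trans (le_add_of_nonneg_right hK0)
  · by_cases h2 : ν < μ
    · have hne : ν ≠ μ := ne_of_lt h2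
      have hne' : μ ≠ ν := hne.symm
      -- `Q = W(∂p_{νμ}(x))`, `Q' = W(∂p_{νμ}(x − e_μ))`; the flat terms carry their inverses
      have hQi : hol W x (plaqWord μ ν) = (hol W x (plaqWord ν μ))⁻¹ := hol_plaqWord_swap' W x ν μ
      have hQ'i : hol W (x - e μ) (plaqWord μ ν) = (hol W (x - e μ) (plaqWord ν μ))⁻¹ := hol_plaqWord_swap' W (x - e μ) ν μ
      have eQ : ‖((hol W x (plaqWord ν μ) : (Matrix n n ℂ)ˣ) : (Matrix n n ℂ)) - 1‖ ≤ ε := (hWε μ ν μ hne).1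
      have eQ' : ‖((hol W (x - e μ) (plaqWord ν μ) : (Matrix n n ℂ)ˣ) : (Matrix n n ℂ)) - 1‖ ≤ ε := (hWε μ ν μ hne).2
      have eQi : ‖(((hol W x (plaqWord ν μ))⁻¹ : (Matrix n n ℂ)ˣ) : (Matrix n n ℂ)) - 1‖ ≤ ε := by rw [← hQi]; exact (hWε μ μ ν hne').1
      have eQ'i : ‖(((hol W (x - e μ) (plaqWord ν μ))⁻¹ : (Matrix n n ℂ)ˣ) : (Matrix n n ℂ)) - 1‖ ≤ ε := by rw [← hQ'i]; exact (hWε μ μ ν hne').2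
      have hval : ((((hol W x (plaqWord μ ν) : (Matrix n n ℂ)ˣ) : (Matrix n n ℂ)) - 1) - (((hol W (x - e μ) (plaqWord μ ν) : (Matrix n n ℂ)ˣ) : (Matrix n n ℂ)) - 1))
          + (if μ < ν then conjR (W (x - e μ) μ)⁻¹ (plaqF W μ ν (x - e μ)) - plaqF W μ ν x
              else if ν < μ then -(conjR (W (x - e μ) μ)⁻¹ (plaqF W ν μ (x - e μ)) - plaqF W ν μ x) else 0)
          = (((((hol W x (plaqWord ν μ))⁻¹ : (Matrix n n ℂ)ˣ) : (Matrix n n ℂ)) - (((hol W (x - e μ) (plaqWord ν μ))⁻¹ : (Matrix n n ℂ)ˣ) : (Matrix n n ℂ)))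
              + (((hol W x (plaqWord ν μ) : (Matrix n n ℂ)ˣ) : (Matrix n n ℂ)) - ((hol W (x - e μ) (plaqWord ν μ) : (Matrix n n ℂ)ˣ) : (Matrix n n ℂ))))
            - (conjR (W (x - e μ) μ)⁻¹ ((hol W (x - e μ) (plaqWord ν μ) : (Matrix n n ℂ)ˣ) : (Matrix n n ℂ))
                - ((hol W (x - e μ) (plaqWord ν μ) : (Matrix n n ℂ)ˣ) : (Matrix n n ℂ))) := by
        simp only [h1, h2, ↓reduceIte, plaqF, hQi, hQ'i]
        abel
      rw [hval]
      refine (norm_sub_le _ _).trans ?_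
      have hA := norm_inv_sub_inv_add_sub_le eQi eQ'i
      have hB := htrans μ (hol W (x - e μ) (plaqWord ν μ)) eQ'
      have hQQ' : ‖((hol W x (plaqWord ν μ) : (Matrix n n ℂ)ˣ) : (Matrix n n ℂ)) - ((hol W (x - e μ) (plaqWord ν μ) : (Matrix n n ℂ)ˣ) : (Matrix n n ℂ))‖ ≤ 2 * ε := by
        have h : ((hol W x (plaqWord ν μ) : (Matrix n n ℂ)ˣ) : (Matrix n n ℂ)) - ((hol W (x - e μ) (plaqWord ν μ) : (Matrix n n ℂ)ˣ) : (Matrix n n ℂ))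
            = (((hol W x (plaqWord ν μ) : (Matrix n n ℂ)ˣ) : (Matrix n n ℂ)) - 1) - (((hol W (x - e μ) (plaqWord ν μ) : (Matrix n n ℂ)ˣ) : (Matrix n n ℂ)) - 1) := by abel
        rw [h]
        exact (norm_sub_le _ _).trans (by linarith)
      have hA' : ‖((((hol W x (plaqWord ν μ))⁻¹ : (Matrix n n ℂ)ˣ) : (Matrix n n ℂ)) - (((hol W (x - e μ) (plaqWord ν μ))⁻¹ : (Matrix n n ℂ)ˣ) : (Matrix n n ℂ)))
            + (((hol W x (plaqWord ν μ) : (Matrix n n ℂ)ˣ) : (Matrix n n ℂ)) - ((hol W (x - e μ) (plaqWord ν μ) : (Matrix n n ℂ)ˣ) : (Matrix n n ℂ)))‖ ≤ 2 * ε * ε * (2 + ε) := by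
        refine hA.trans ?_
        have hε2 : 0 ≤ ε * (2 + ε) := mul_nonneg hε0 (by linarith)
        calc ε * (2 + ε) * ‖((hol W x (plaqWord ν μ) : (Matrix n n ℂ)ˣ) : (Matrix n n ℂ)) - ((hol W (x - e μ) (plaqWord ν μ) : (Matrix n n ℂ)ˣ) : (Matrix n n ℂ))‖
            ≤ ε * (2 + ε) * (2 * ε) := mul_le_mul_of_nonneg_left hQQ' hε2
          _ = 2 * ε * ε * (2 + ε) := by ring
      linarith
    · -- `μ = ν`: everything vanishes
      have hμν : μ = ν := le_antisymm (not_lt.mp h2) (not_lt.mp h1)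
      subst hμν
      have hval : ((((hol W x (plaqWord μ μ) : (Matrix n n ℂ)ˣ) : (Matrix n n ℂ)) - 1) - (((hol W (x - e μ) (plaqWord μ μ) : (Matrix n n ℂ)ˣ) : (Matrix n n ℂ)) - 1))
          + (if μ < μ then conjR (W (x - e μ) μ)⁻¹ (plaqF W μ μ (x - e μ)) - plaqF W μ μ x
              else if μ < μ then -(conjR (W (x - e μ) μ)⁻¹ (plaqF W μ μ (x - e μ)) - plaqF W μ μ x) else 0) = 0 := by
        simp only [lt_irrefl, ↓reduceIte, hol_plaqWord_self, Units.val_one, sub_self, add_zero]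
      rw [hval, norm_zero]
      exact add_nonneg (mul_nonneg (mul_nonneg hε0 hb0) (by linarith)) hK0


/-! ### Lattice neighbourhoods (sup-norm) -/

omit [Fintype n] [DecidableEq n] [Nonempty n] in
/-- `|e_μ(i)| ≤ 1`. [folklore] -/
theorem abs_e_apply_le (μ i : Fin d) : |(e μ : Site d) i| ≤ 1 := by
  rw [e_apply]; split_ifs <;> simp

omit [Fintype n] [DecidableEq n] [Nonempty n] in
/-- `y + e_μ` is within sup-distance `1` of `y`. [folklore] -/
theorem near_add_e (y : Site d) (μ : Fin d) : ∀ i, |(y + e μ) i - y i| ≤ 1 := fun i => by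
  rw [Pi.add_apply, add_sub_cancel_left]; exact abs_e_apply_le μ i

omit [Fintype n] [DecidableEq n] [Nonempty n] in
/-- `y − e_μ` is within sup-distance `1` of `y`. [folklore] -/
theorem near_sub_e (y : Site d) (μ : Fin d) : ∀ i, |(y - e μ) i - y i| ≤ 1 := fun i => by
  rw [Pi.sub_apply, show y i - (e μ : Site d) i - y i = -((e μ : Site d) i) by ring, abs_neg]; exact abs_e_apply_le μ i

omit [Fintype n] [DecidableEq n] [Nonempty n] in
/-- `y − e_μ + e_ν` is within sup-distance `1` of `y`. [folklore] -/
theorem near_sub_add_e (y : Site d) (μ ν : Fin d) : ∀ i, |(y - e μ + e ν) i - y i| ≤ 1 := fun i => by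
  rw [Pi.add_apply, Pi.sub_apply, show y i - (e μ : Site d) i + (e ν : Site d) i - y i = (e ν : Site d) i - (e μ : Site d) i by ring,
    e_apply, e_apply]
  split_ifs <;> simp

omit [Fintype n] [DecidableEq n] [Nonempty n] in
/-- `y` is within sup-distance `1` of itself. [folklore] -/
theorem near_self (y : Site d) : ∀ i, |y i - y i| ≤ 1 := fun i => by simp

omit [Fintype n] [DecidableEq n] [Nonempty n] in
/-- Triangle inequality for sup-neighbourhoods. [folklore] -/
theorem near_trans {z y x : Site d} {a b : ℤ} (hzy : ∀ i, |z i - y i| ≤ a) (hyx : ∀ i, |y i - x i| ≤ b) : ∀ i, |z i - x i| ≤ a + b := fun i => by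
  have := abs_add_le (z i - y i) (y i - x i)
  rw [show z i - y i + (y i - x i) = z i - x i by ring] at this
  linarith [hzy i, hyx i]

/-! ### The curl-divergence and the reaction gradient, locally -/

omit [Nonempty n] in
/-- The four-factor product from four bond equalities: if `W = expUnit A` on the bonds of the plaquette `∂p_{μν}(z)`, then
`W(∂p_{μν}(z)) = e^{A(z)_μ} e^{A(z+e_μ)_ν} e^{−A(z+e_ν)_μ} e^{−A(z)_ν}`. [folklore] -/
theorem hol_plaqWord_exp_local (W : Site d → Fin d → (Matrix n n ℂ)ˣ) (A : Site d → Fin d → Matrix n n ℂ) (z : Site d) (μ ν : Fin d)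
    (h1 : W z μ = expUnit (A z μ)) (h2 : W (z + e μ) ν = expUnit (A (z + e μ) ν)) (h3 : W (z + e ν) μ = expUnit (A (z + e ν) μ))
    (h4 : W z ν = expUnit (A z ν)) :
    ((hol W z (plaqWord μ ν) : (Matrix n n ℂ)ˣ) : Matrix n n ℂ) = exp (A z μ) * exp (A (z + e μ) ν) * exp (-A (z + e ν) μ) * exp (-A z ν) := by
  rw [B7Prop1Local.hol_plaqWord_eq, h1, h2, h3, h4]
  simp only [Units.val_mul, val_inv_expUnit, val_expUnit]

/-- **THE CO-DIFFERENTIAL OF THE LINEAR CURL FROM THE PLAQUETTE DIVERGENCE, LOCAL HYPOTHESES** (clone of F5 `NE7LandauLaplacianLetter.norm_curlDiv_le_of_plaqDiv`): at a site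
`y` and component `ν`, if `W = expUnit A` and `‖A‖ ≤ ρ` on the sup-neighbourhood `{|z − y|_∞ ≤ 1}`, `G` bounds the forward differences of `A` based there, and `J` bounds the
flat co-differential of the plaquette deviation of `W` at `(y, ν)`: `‖Σ_μ [dA(y;μ,ν) − dA(y−e_μ;μ,ν)]‖ ≤ J + 4d(e^{4ρ} − 1)·G`. [folklore] -/
theorem norm_curlDiv_le_of_plaqDiv_local (W : Site d → Fin d → (Matrix n n ℂ)ˣ) (A : Site d → Fin d → Matrix n n ℂ) {ρ G J : ℝ}
    (y : Site d) (ν : Fin d)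
    (hWexp : ∀ z : Site d, (∀ i, |z i - y i| ≤ 1) → ∀ κ : Fin d, W z κ = expUnit (A z κ))
    (hA : ∀ z : Site d, (∀ i, |z i - y i| ≤ 1) → ∀ κ : Fin d, ‖A z κ‖ ≤ ρ)
    (hG : ∀ z : Site d, (∀ i, |z i - y i| ≤ 1) → ∀ κ τ : Fin d, ‖A (z + e τ) κ - A z κ‖ ≤ G)
    (hJ : ‖∑ μ, ((((hol W y (plaqWord μ ν) : (Matrix n n ℂ)ˣ) : Matrix n n ℂ) - 1)
              - (((hol W (y - e μ) (plaqWord μ ν) : (Matrix n n ℂ)ˣ) : Matrix n n ℂ) - 1))‖ ≤ J) :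
    ‖∑ μ, ((A y μ + A (y + e μ) ν - A (y + e ν) μ - A y ν)
            - (A (y - e μ) μ + A (y - e μ + e μ) ν - A (y - e μ + e ν) μ - A (y - e μ) ν))‖
      ≤ J + 4 * d * (Real.exp (4 * ρ) - 1) * G := by
  have hy0 := near_self y
  have hrem : ∀ (μ : Fin d) (z : Site d), (∀ i, |z i - y i| ≤ 1) → (∀ i, |(z + e μ) i - y i| ≤ 1) → (∀ i, |(z + e ν) i - y i| ≤ 1) →
      (A z μ + A (z + e μ) ν - A (z + e ν) μ - A z ν)
        = (((hol W z (plaqWord μ ν) : (Matrix n n ℂ)ˣ) : Matrix n n ℂ) - 1)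
          - (exp (A z μ) * exp (A (z + e μ) ν) * exp (-A (z + e ν) μ) * exp (-A z ν) - 1
              - (A z μ + A (z + e μ) ν + -A (z + e ν) μ + -A z ν)) := by
    intro μ z hz1 hzμ hzν
    rw [hol_plaqWord_exp_local W A z μ ν (hWexp z hz1 μ) (hWexp _ hzμ ν) (hWexp _ hzν μ) (hWexp z hz1 ν)]
    abel
  have hymm : ∀ μ : Fin d, ∀ i, |(y - e μ + e μ) i - y i| ≤ 1 := fun μ i => by rw [sub_add_cancel]; exact hy0 i
  have hG0 : 0 ≤ G := (norm_nonneg _).trans (hG y hy0 ν ν)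
  have hdiff : ∀ μ : Fin d,
      ‖(exp (A y μ) * exp (A (y + e μ) ν) * exp (-A (y + e ν) μ) * exp (-A y ν) - 1
            - (A y μ + A (y + e μ) ν + -A (y + e ν) μ + -A y ν))
        - (exp (A (y - e μ) μ) * exp (A (y - e μ + e μ) ν) * exp (-A (y - e μ + e ν) μ) * exp (-A (y - e μ) ν) - 1
            - (A (y - e μ) μ + A (y - e μ + e μ) ν + -A (y - e μ + e ν) μ + -A (y - e μ) ν))‖
        ≤ (Real.exp (4 * ρ) - 1) * (4 * G) := by
    intro μ
    have hyμ := near_add_e y μ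
    have hyν := near_add_e y ν
    have hymμ := near_sub_e y μ
    have hymμν := near_sub_add_e y μ ν
    have hymμμ : ∀ i, |(y - e μ + e μ) i - y i| ≤ 1 := fun i => by rw [sub_add_cancel]; exact hy0 i
    have h := norm_plaqRem_sub_plaqRem_le (hA y hy0 μ) (hA _ hyμ ν) (by rw [norm_neg]; exact hA _ hyν μ)
      (by rw [norm_neg]; exact hA y hy0 ν) (hA _ hymμ μ) (hA _ hymμμ ν)
      (by rw [norm_neg]; exact hA _ hymμν μ) (by rw [norm_neg]; exact hA _ hymμ ν)
    refine h.trans (mul_le_mul_of_nonneg_left ?_ ?_)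
    · have h1 : ‖A y μ - A (y - e μ) μ‖ ≤ G := by
        have := hG (y - e μ) hymμ μ μ; rwa [sub_add_cancel] at this
      have h2 : ‖A (y + e μ) ν - A (y - e μ + e μ) ν‖ ≤ G := by
        have := hG (y - e μ + e μ) hymμμ ν μ
        simp only [sub_add_cancel] at this ⊢
        exact this
      have h3 : ‖-A (y + e ν) μ - -A (y - e μ + e ν) μ‖ ≤ G := by
        have := hG (y - e μ + e ν) hymμν μ μ
        rw [show y - e μ + e ν + e μ = y + e ν by abel] at this
        rw [show -A (y + e ν) μ - -A (y - e μ + e ν) μ = -(A (y + e ν) μ - A (y - e μ + e ν) μ) by abel, norm_neg]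
        exact this
      have h4 : ‖-A y ν - -A (y - e μ) ν‖ ≤ G := by
        have := hG (y - e μ) hymμ ν μ
        rw [sub_add_cancel] at this
        rw [show -A y ν - -A (y - e μ) ν = -(A y ν - A (y - e μ) ν) by abel, norm_neg]
        exact this
      linarith
    · have hρ0 : 0 ≤ ρ := (norm_nonneg _).trans (hA y hy0 ν)
      have := Real.one_le_exp (by positivity : 0 ≤ 4 * ρ)
      linarith
  have hsplit : ∑ μ, ((A y μ + A (y + e μ) ν - A (y + e ν) μ - A y ν)
        - (A (y - e μ) μ + A (y - e μ + e μ) ν - A (y - e μ + e ν) μ - A (y - e μ) ν))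
      = ∑ μ, ((((hol W y (plaqWord μ ν) : (Matrix n n ℂ)ˣ) : Matrix n n ℂ) - 1) - (((hol W (y - e μ) (plaqWord μ ν) : (Matrix n n ℂ)ˣ) : Matrix n n ℂ) - 1))
        - ∑ μ, ((exp (A y μ) * exp (A (y + e μ) ν) * exp (-A (y + e ν) μ) * exp (-A y ν) - 1
            - (A y μ + A (y + e μ) ν + -A (y + e ν) μ + -A y ν))
          - (exp (A (y - e μ) μ) * exp (A (y - e μ + e μ) ν) * exp (-A (y - e μ + e ν) μ) * exp (-A (y - e μ) ν) - 1
            - (A (y - e μ) μ + A (y - e μ + e μ) ν + -A (y - e μ + e ν) μ + -A (y - e μ) ν))) := by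
    rw [← Finset.sum_sub_distrib]
    refine Finset.sum_congr rfl fun μ _ => ?_
    rw [hrem μ y hy0 (near_add_e y μ) (near_add_e y ν), hrem μ (y - e μ) (near_sub_e y μ) (hymm μ) (near_sub_add_e y μ ν)]
    abel
  rw [hsplit]
  refine (norm_sub_le _ _).trans ?_
  have hsum : ‖∑ μ : Fin d, ((exp (A y μ) * exp (A (y + e μ) ν) * exp (-A (y + e ν) μ) * exp (-A y ν) - 1
            - (A y μ + A (y + e μ) ν + -A (y + e ν) μ + -A y ν))
          - (exp (A (y - e μ) μ) * exp (A (y - e μ + e μ) ν) * exp (-A (y - e μ + e ν) μ) * exp (-A (y - e μ) ν) - 1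
            - (A (y - e μ) μ + A (y - e μ + e μ) ν + -A (y - e μ + e ν) μ + -A (y - e μ) ν)))‖
      ≤ 4 * d * (Real.exp (4 * ρ) - 1) * G := by
    refine (norm_sum_le _ _).trans ?_
    calc _ ≤ ∑ _μ : Fin d, (Real.exp (4 * ρ) - 1) * (4 * G) := Finset.sum_le_sum fun μ _ => hdiff μ
      _ = 4 * d * (Real.exp (4 * ρ) - 1) * G := by
          rw [Finset.sum_const, Finset.card_univ, Fintype.card_fin, nsmul_eq_mul]; ring
  exact add_le_add hJ hsum

/-- **THE TWO REACTION GRADIENTS, LOCAL HYPOTHESES** (clone of (158b) `NE7GradientCurrencyLandauEL.norm_dDiv_sub_dDiv_sinh_le`): at `(x, ν)`, with `‖A‖ ≤ ρ` and the gradient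
bound `G` on the sup-neighbourhood `{|z − x|_∞ ≤ 1}`, the forward differences of `div A` and of `div sinh A` differ by at most `2d(e^ρ − 1)·G`. [folklore] -/
theorem norm_dDiv_sub_dDiv_sinh_le_local (A : Site d → Fin d → (Matrix n n ℂ)) {ρ G : ℝ} (x : Site d) (ν : Fin d)
    (hA : ∀ z : Site d, (∀ i, |z i - x i| ≤ 1) → ∀ κ : Fin d, ‖A z κ‖ ≤ ρ)
    (hG : ∀ z : Site d, (∀ i, |z i - x i| ≤ 1) → ∀ κ τ : Fin d, ‖A (z + e τ) κ - A z κ‖ ≤ G) :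
    ‖(∑ μ, (A (x + e ν) μ - A (x + e ν - e μ) μ) - ∑ μ, (A x μ - A (x - e μ) μ))
      - (∑ μ, (((2 : ℂ)⁻¹ • (exp (A (x + e ν) μ) - exp (-A (x + e ν) μ)))
                - ((2 : ℂ)⁻¹ • (exp (A (x + e ν - e μ) μ) - exp (-A (x + e ν - e μ) μ))))
          - ∑ μ, (((2 : ℂ)⁻¹ • (exp (A x μ) - exp (-A x μ))) - ((2 : ℂ)⁻¹ • (exp (A (x - e μ) μ) - exp (-A (x - e μ) μ)))))‖
      ≤ 2 * d * (Real.exp ρ - 1) * G := by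
  set T : Site d → Fin d → (Matrix n n ℂ) := fun y μ => (2 : ℂ)⁻¹ • (exp (A y μ) - exp (-A y μ)) - A y μ with hT
  have hid : (∑ μ, (A (x + e ν) μ - A (x + e ν - e μ) μ) - ∑ μ, (A x μ - A (x - e μ) μ))
      - (∑ μ, (((2 : ℂ)⁻¹ • (exp (A (x + e ν) μ) - exp (-A (x + e ν) μ)))
                - ((2 : ℂ)⁻¹ • (exp (A (x + e ν - e μ) μ) - exp (-A (x + e ν - e μ) μ))))
          - ∑ μ, (((2 : ℂ)⁻¹ • (exp (A x μ) - exp (-A x μ))) - ((2 : ℂ)⁻¹ • (exp (A (x - e μ) μ) - exp (-A (x - e μ) μ)))))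
      = -(∑ μ, ((T (x + e ν) μ - T x μ) - (T (x + e ν - e μ) μ - T (x - e μ) μ))) := by
    simp only [hT, Finset.sum_sub_distrib]
    abel
  rw [hid, norm_neg]
  have hx0 := near_self x
  have hLip : ∀ (y : Site d) (μ : Fin d), (∀ i, |y i - x i| ≤ 1) → (∀ i, |(y + e ν) i - x i| ≤ 1) → ‖T (y + e ν) μ - T y μ‖ ≤ (Real.exp ρ - 1) * G := by
    intro y μ hy hyν
    have h := norm_sinhRem_sub_sinhRem_le (hA _ hyν μ) (hA y hy μ)
    simp only [hT]
    refine h.trans (mul_le_mul_of_nonneg_left (hG y hy μ ν) ?_)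
    have hρ0 : 0 ≤ ρ := (norm_nonneg _).trans (hA y hy μ)
    have := Real.add_one_le_exp ρ
    linarith
  refine (norm_sum_le _ _).trans ?_
  calc ∑ μ, ‖(T (x + e ν) μ - T x μ) - (T (x + e ν - e μ) μ - T (x - e μ) μ)‖
      ≤ ∑ _μ : Fin d, ((Real.exp ρ - 1) * G + (Real.exp ρ - 1) * G) := Finset.sum_le_sum fun μ _ => by
          refine (norm_sub_le _ _).trans (add_le_add (hLip x μ hx0 (near_add_e x ν)) ?_)
          have h := hLip (x - e μ) μ (near_sub_e x μ) (near_sub_add_e x μ ν)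
          rwa [show x - e μ + e ν = x + e ν - e μ by abel] at h
    _ = 2 * d * (Real.exp ρ - 1) * G := by
        rw [Finset.sum_const, Finset.card_univ, Fintype.card_fin, nsmul_eq_mul]; ring

omit [Fintype n] [DecidableEq n] [Nonempty n] in
/-- Monotonicity of sup-neighbourhoods in the radius. [folklore] -/
theorem near_mono {z x : Site d} {a b : ℤ} (h : ∀ i, |z i - x i| ≤ a) (hab : a ≤ b) : ∀ i, |z i - x i| ≤ b := fun i => (h i).trans hab



end

end Summit.QuantumFields.BalabanUV.T4Continuum.NE7LocalLandauLetters
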